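import Summits.CriticalPhenomena.PercolationContinuityZ3.Theorems.PercAnnulusCrossingIICOuterCluster
import HarnessLib

/-!
# Points at separated scales join Kesten's IIC at least quasi-independently: a multipoint lower bound under `CU⁺_l` (lane RSW3, p1 gen 19)

builds on p205010 (kernel theorem, internal audit signed; external expert review pending) — NOT used in this file.

RSW3 lane (LANE 3 `prim-rsw3`), seat `prim-rsw3-p1` (gen 19).  Helper file (`--supports stmt-CriticalPhenomena-4575`);
no definitions, no sorries; every `d`, every `p`.  Memo `run/shared/lean/prim/rsw3/P1-QM.md` §32.

Iterating the quenched two-point bound of gen 19 (3) (`c·τ_p^{Λ(R)}(0,x)·ν(D) ≤ ν(D ∩ {0 ↔ x in Λ(R)})` for `D ∈ σ(Λ(a−1))`,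
`x ∉ Λ(la−1)`, `R ≥ la`) along nested scales `a_0 < a_1 < ⋯` (`l·a_i + 1 ≤ a_{i+1}`), with sites `x_i ∉ Λ(l a_i − 1)` read in the box
`Λ(a_{i+1} − 1)`:

* **`iicMeasure_real_inter_biInter_openConnIn_ge_prod`** — under `CU⁺_l(c)`, for every finite measure `ν` with Kesten's IIC limit property and
  every `D ∈ σ(Λ(a_0 − 1))`:
  **`c^k · ∏_{i<k} P_p(0 ↔ x_i in Λ(a_{i+1} − 1)) · ν(D) ≤ ν(D ∩ ⋂_{i<k} {0 ↔ x_i in Λ(a_{i+1} − 1)})`**;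
* `iicMeasure_real_biInter_openConnIn_ge_prod` — `D = univ`; `iicMeasure_real_biInter_openConn_ge_prod` — with the global connections
  `{0 ↔ x_i}`: **`ν(x_0, …, x_{k−1} ∈ C(0)) ≥ c^k ∏_{i<k} τ_p^{Λ(a_{i+1}−1)}(0, x_i) · ν(univ)`** — k far points at separated scales belong
  to the IIC with probability at least the product of `c_U ×` their finite-volume Bernoulli connectivities to the root.  Only the robust
  conditional annulus-uniqueness is used (no quasi-multiplicativity); the rate is that of `τ_p`, not of the one-arm probability (for the
  sharp one-arm rate at a single point given an inner ATOM see gen 18 (13), which needs (A2)□).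
References: H. Kesten, Probab. Theory Relat. Fields 73 (1986) §2 and Thm. (8); G. Grimmett, *Percolation* (1999), Thm. (2.4).
-/

noncomputable section

namespace Summit.CriticalPhenomena.PercolationContinuityZ3.Theorems.Crossing

open MeasureTheory Filter Topology Literature.Probability.Percolation Literature.Probability.LatticeModels
open Literature.Probability.Percolation.DCT16
open Summit.CriticalPhenomena.PercolationContinuityZ3.Theorems.SurfaceTension

variable {d : ℕ}

/-- **MULTIPOINT LOWER BOUND ACROSS SEPARATED SCALES, GIVEN THE INSIDE** (every `d`, `p`; `CU⁺_l(c)`, `l ≥ 2`, `c ≥ 0`; nested scales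
`a_i ≥ 1`, `l·a_i + 1 ≤ a_{i+1}`; sites `x_i ∉ Λ(l a_i − 1)`): for every finite measure `ν` with Kesten's IIC limit property, every measurable
`D` determined by the pairs of `Λ(a_0 − 1)` and every `k`:
**`c^k · (∏_{i<k} P_p(0 ↔ x_i in Λ(a_{i+1} − 1))) · ν(D) ≤ ν(D ∩ ⋂_{i<k} {0 ↔ x_i in Λ(a_{i+1} − 1)})`**.
Induction on `k`: the events up to step `k` are cylinders of `Λ(a_k − 1)`, and gen 19 (3) adds the point `x_k` across the glued annulus
`R(a_k, l a_k)`. [cite: Kesten1986, §2] -/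
theorem iicMeasure_real_inter_biInter_openConnIn_ge_prod (p : unitInterval) {l : ℕ} (hl : 2 ≤ l) {c : ℝ} (hc : 0 ≤ c)
    (hCU : ∀ a : ℕ, 1 ≤ a → ∀ E : Set (BondConfig (Site d)), IsUpperSet E → MeasurableSet E →
      c * (bondPercolation (zdGraph d) p).real E ≤ (bondPercolation (zdGraph d) p).real (E ∩
        {ω : BondConfig (Site d) | ∀ t ∈ innerBoundary (zdGraph d) (box d a), ∀ s ∈ innerBoundary (zdGraph d) (box d (l * a)),
        ∀ t' ∈ innerBoundary (zdGraph d) (box d a), ∀ s' ∈ innerBoundary (zdGraph d) (box d (l * a)),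
        ω ∈ openConnIn (↑((box d (l * a) \ box d a) ∪ innerBoundary (zdGraph d) (box d a)) : Set (Site d)) t s →
        ω ∈ openConnIn (↑((box d (l * a) \ box d a) ∪ innerBoundary (zdGraph d) (box d a)) : Set (Site d)) t' s' →
        ω ∈ openConnIn (↑((box d (l * a) \ box d a) ∪ innerBoundary (zdGraph d) (box d a)) : Set (Site d)) s s'}))
    {ν : Measure (BondConfig (Site d))} [IsFiniteMeasure ν]
    (hν : ∀ (F : Finset (Sym2 (Site d))) (E : Set (BondConfig (Site d))), MeasurableSet E → DeterminedBy E ↑F →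
      Tendsto (fun n : ℕ => (bondPercolation (zdGraph d) p).real (E ∩ siteToBoundary d n) / oneArmProb d p n)
        atTop (𝓝 (ν.real E)))
    (a : ℕ → ℕ) (ha1 : ∀ i, 1 ≤ a i) (hnest : ∀ i, l * a i + 1 ≤ a (i + 1)) (x : ℕ → Site d)
    (hx : ∀ i, x i ∉ box d (l * a i - 1)) {D : Set (BondConfig (Site d))}
    (hD : DeterminedBy D (↑((box d (a 0 - 1)).sym2) : Set (Sym2 (Site d)))) (hDm : MeasurableSet D) (k : ℕ) :
    c ^ k * (∏ i ∈ Finset.range k, (bondPercolation (zdGraph d) p).real (openConnIn (↑(box d (a (i + 1) - 1)) : Set (Site d)) 0 (x i))) *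
        ν.real D ≤
      ν.real (D ∩ ⋂ i ∈ Finset.range k, openConnIn (↑(box d (a (i + 1) - 1)) : Set (Site d)) 0 (x i)) := by
  set μ := bondPercolation (zdGraph d) p with hμ
  have hamono : Monotone a := monotone_nat_of_le_succ fun i => by nlinarith [hnest i, ha1 i]
  -- the events up to step `k` are cylinders of `Λ(a_k − 1)`
  have hdet : ∀ k, DeterminedBy (D ∩ ⋂ i ∈ Finset.range k, openConnIn (↑(box d (a (i + 1) - 1)) : Set (Site d)) 0 (x i))
      (↑((box d (a k - 1)).sym2) : Set (Sym2 (Site d))) := by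
    intro k
    refine (hD.mono (Finset.coe_subset.2 (Finset.sym2_mono (box_mono d (Nat.sub_le_sub_right (hamono (Nat.zero_le k)) 1))))).inter ?_
    refine DeterminedBy.iInter fun i => DeterminedBy.iInter fun hi => ?_
    have hik : a (i + 1) - 1 ≤ a k - 1 := Nat.sub_le_sub_right (hamono (Nat.succ_le_of_lt (Finset.mem_range.1 hi))) 1
    exact (determinedBy_openConnIn _ 0 (x i) (by rw [Finset.coe_sym2])).mono (Finset.coe_subset.2 (Finset.sym2_mono (box_mono d hik)))
  have hmeas : ∀ k, MeasurableSet (D ∩ ⋂ i ∈ Finset.range k, openConnIn (↑(box d (a (i + 1) - 1)) : Set (Site d)) 0 (x i)) :=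
    fun k => hDm.inter (Finset.measurableSet_biInter _ fun i _ => measurableSet_openConnIn _ 0 (x i))
  induction k with
  | zero => simp
  | succ k ih =>
    have hR : l * a k ≤ a (k + 1) - 1 := by have := hnest k; omega
    have hstep := iicMeasure_real_inter_openConnIn_ge_mul_tau p hl hc hCU hν (ha1 k) hR (hdet k) (hmeas k) (hx k)
    have hτ0 : 0 ≤ c * μ.real (openConnIn (↑(box d (a (k + 1) - 1)) : Set (Site d)) 0 (x k)) := mul_nonneg hc measureReal_nonneg
    rw [Finset.prod_range_succ, Finset.range_add_one, Finset.set_biInter_insert]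
    calc c ^ (k + 1) * ((∏ i ∈ Finset.range k, μ.real (openConnIn (↑(box d (a (i + 1) - 1)) : Set (Site d)) 0 (x i))) *
          μ.real (openConnIn (↑(box d (a (k + 1) - 1)) : Set (Site d)) 0 (x k))) * ν.real D
        = c * μ.real (openConnIn (↑(box d (a (k + 1) - 1)) : Set (Site d)) 0 (x k)) *
            (c ^ k * (∏ i ∈ Finset.range k, μ.real (openConnIn (↑(box d (a (i + 1) - 1)) : Set (Site d)) 0 (x i))) * ν.real D) := by
          ring
      _ ≤ c * μ.real (openConnIn (↑(box d (a (k + 1) - 1)) : Set (Site d)) 0 (x k)) *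
            ν.real (D ∩ ⋂ i ∈ Finset.range k, openConnIn (↑(box d (a (i + 1) - 1)) : Set (Site d)) 0 (x i)) :=
          mul_le_mul_of_nonneg_left ih hτ0
      _ ≤ ν.real ((D ∩ ⋂ i ∈ Finset.range k, openConnIn (↑(box d (a (i + 1) - 1)) : Set (Site d)) 0 (x i)) ∩
            openConnIn (↑(box d (a (k + 1) - 1)) : Set (Site d)) 0 (x k)) := hstep
      _ = ν.real (D ∩ (openConnIn (↑(box d (a (k + 1) - 1)) : Set (Site d)) 0 (x k) ∩
            ⋂ i ∈ Finset.range k, openConnIn (↑(box d (a (i + 1) - 1)) : Set (Site d)) 0 (x i))) := by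
          congr 1; ext ω; simp only [Set.mem_inter_iff]; tauto

/-- **MULTIPOINT LOWER BOUND ACROSS SEPARATED SCALES** (`D = univ`): under `CU⁺_l(c)`, for every finite measure `ν` with Kesten's IIC limit
property: **`c^k · ∏_{i<k} P_p(0 ↔ x_i in Λ(a_{i+1} − 1)) · ν(univ) ≤ ν(⋂_{i<k} {0 ↔ x_i in Λ(a_{i+1} − 1)})`**. [cite: Kesten1986, §2] -/
theorem iicMeasure_real_biInter_openConnIn_ge_prod (p : unitInterval) {l : ℕ} (hl : 2 ≤ l) {c : ℝ} (hc : 0 ≤ c)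
    (hCU : ∀ a : ℕ, 1 ≤ a → ∀ E : Set (BondConfig (Site d)), IsUpperSet E → MeasurableSet E →
      c * (bondPercolation (zdGraph d) p).real E ≤ (bondPercolation (zdGraph d) p).real (E ∩
        {ω : BondConfig (Site d) | ∀ t ∈ innerBoundary (zdGraph d) (box d a), ∀ s ∈ innerBoundary (zdGraph d) (box d (l * a)),
        ∀ t' ∈ innerBoundary (zdGraph d) (box d a), ∀ s' ∈ innerBoundary (zdGraph d) (box d (l * a)),
        ω ∈ openConnIn (↑((box d (l * a) \ box d a) ∪ innerBoundary (zdGraph d) (box d a)) : Set (Site d)) t s →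
        ω ∈ openConnIn (↑((box d (l * a) \ box d a) ∪ innerBoundary (zdGraph d) (box d a)) : Set (Site d)) t' s' →
        ω ∈ openConnIn (↑((box d (l * a) \ box d a) ∪ innerBoundary (zdGraph d) (box d a)) : Set (Site d)) s s'}))
    {ν : Measure (BondConfig (Site d))} [IsFiniteMeasure ν]
    (hν : ∀ (F : Finset (Sym2 (Site d))) (E : Set (BondConfig (Site d))), MeasurableSet E → DeterminedBy E ↑F →
      Tendsto (fun n : ℕ => (bondPercolation (zdGraph d) p).real (E ∩ siteToBoundary d n) / oneArmProb d p n)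
        atTop (𝓝 (ν.real E)))
    (a : ℕ → ℕ) (ha1 : ∀ i, 1 ≤ a i) (hnest : ∀ i, l * a i + 1 ≤ a (i + 1)) (x : ℕ → Site d)
    (hx : ∀ i, x i ∉ box d (l * a i - 1)) (k : ℕ) :
    c ^ k * (∏ i ∈ Finset.range k, (bondPercolation (zdGraph d) p).real (openConnIn (↑(box d (a (i + 1) - 1)) : Set (Site d)) 0 (x i))) *
        ν.real Set.univ ≤
      ν.real (⋂ i ∈ Finset.range k, openConnIn (↑(box d (a (i + 1) - 1)) : Set (Site d)) 0 (x i)) := by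
  have h := iicMeasure_real_inter_biInter_openConnIn_ge_prod p hl hc hCU hν a ha1 hnest x hx
    (Literature.Probability.Percolation.determinedBy_univ _) MeasurableSet.univ k
  rwa [Set.univ_inter] at h

/-- **`k` FAR POINTS AT SEPARATED SCALES BELONG TO THE IIC WITH PROBABILITY AT LEAST `c^k ∏ τ`**: under `CU⁺_l(c)`, for every finite measure `ν`
with Kesten's IIC limit property: **`c^k · ∏_{i<k} P_p(0 ↔ x_i in Λ(a_{i+1} − 1)) · ν(univ) ≤ ν(⋂_{i<k} {0 ↔ x_i})`** (global connections).
[cite: Kesten1986, §2] -/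
theorem iicMeasure_real_biInter_openConn_ge_prod (p : unitInterval) {l : ℕ} (hl : 2 ≤ l) {c : ℝ} (hc : 0 ≤ c)
    (hCU : ∀ a : ℕ, 1 ≤ a → ∀ E : Set (BondConfig (Site d)), IsUpperSet E → MeasurableSet E →
      c * (bondPercolation (zdGraph d) p).real E ≤ (bondPercolation (zdGraph d) p).real (E ∩
        {ω : BondConfig (Site d) | ∀ t ∈ innerBoundary (zdGraph d) (box d a), ∀ s ∈ innerBoundary (zdGraph d) (box d (l * a)),
        ∀ t' ∈ innerBoundary (zdGraph d) (box d a), ∀ s' ∈ innerBoundary (zdGraph d) (box d (l * a)),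
        ω ∈ openConnIn (↑((box d (l * a) \ box d a) ∪ innerBoundary (zdGraph d) (box d a)) : Set (Site d)) t s →
        ω ∈ openConnIn (↑((box d (l * a) \ box d a) ∪ innerBoundary (zdGraph d) (box d a)) : Set (Site d)) t' s' →
        ω ∈ openConnIn (↑((box d (l * a) \ box d a) ∪ innerBoundary (zdGraph d) (box d a)) : Set (Site d)) s s'}))
    {ν : Measure (BondConfig (Site d))} [IsFiniteMeasure ν]
    (hν : ∀ (F : Finset (Sym2 (Site d))) (E : Set (BondConfig (Site d))), MeasurableSet E → DeterminedBy E ↑F →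
      Tendsto (fun n : ℕ => (bondPercolation (zdGraph d) p).real (E ∩ siteToBoundary d n) / oneArmProb d p n)
        atTop (𝓝 (ν.real E)))
    (a : ℕ → ℕ) (ha1 : ∀ i, 1 ≤ a i) (hnest : ∀ i, l * a i + 1 ≤ a (i + 1)) (x : ℕ → Site d)
    (hx : ∀ i, x i ∉ box d (l * a i - 1)) (k : ℕ) :
    c ^ k * (∏ i ∈ Finset.range k, (bondPercolation (zdGraph d) p).real (openConnIn (↑(box d (a (i + 1) - 1)) : Set (Site d)) 0 (x i))) *
        ν.real Set.univ ≤
      ν.real (⋂ i ∈ Finset.range k, (openConn (0 : Site d) (x i) : Set (BondConfig (Site d)))) := by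
  refine (iicMeasure_real_biInter_openConnIn_ge_prod p hl hc hCU hν a ha1 hnest x hx k).trans (measureReal_mono ?_)
  exact Set.biInter_mono (fun i hi => hi) fun i _ ω hω => DCT16.reachable_of_pathIn (pathIn_of_mem_openConnIn hω)

end Summit.CriticalPhenomena.PercolationContinuityZ3.Theorems.Crossing

end
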